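import Summits.CriticalPhenomena.PercolationContinuityZ3.Theorems.PercNearOneGluingNoHeavyLowerTailSahiSharedTwoPointCube
import Summits.CriticalPhenomena.PercolationContinuityZ3.Theorems.PercNearOneGluingNoHeavyLowerTailSahiLevelSplit
import Mathlib.Tactic.Linarith
import HarnessLib

/-!
# `NoHeavyLowerTail` (crux stmt-CriticalPhenomena-4575), P2 — THE `c`-DECOUPLING FACE of Kahn's `C_3`: one more shared coordinate, paid by
# gen 25's level-splitting defect (single-cube form)

Support file (seat `prim-masterthm-p2`, gen 26; `--supports stmt-CriticalPhenomena-4575`; memo `FROM-prim-masterthm-p2-g26-LEX-CHAIN.md` §3).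
No `sorry`, no definitions, standard axioms.

**THEOREM (`sahiE_three_nonneg_of_levelDefect_nonneg_of_shared_le_one`).**  Increasing events `X, Y, Z ⊆ 2^κ`, a coordinate `c` such that `X` and `Y`
share at most one essential coordinate OTHER THAN `c` (`Z` unrestricted), and a product measure `μ_p` at which gen 25's level-splitting defect of `X`
at `c` is nonnegative (`SahiLevelSplit.sahiE_three_eq_levelSplit`:
`E_3 = (1−p_c)E_3(X^{c←0},Y,Z) + p_c E_3(X^{c←1},Y,Z) + p_c(1−p_c) D_X^{(c)}`).  Then `E_3(μ_p; 1_X,1_Y,1_Z) ≥ 0`: the frozen triples share at most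
one essential coordinate between their first two members, hence are nonnegative by THEOREM A on one cube
(`SahiSharedTwoPointCube.sahiE_three_nonneg_of_esupp_inter_subsingleton`).
For `T₁(|C| = 1)` — `f(z,c,a), g(z,c,b), h(z,a,b)`, `h` free of `c` — the defect is `D_c = 2μ(hPQ) − μ(h)μ(PQ)` (`P, Q` the `c`-pivotal sets of
`f, g`): Kahn's `C_3` on `T₁(|C| = 1)` whenever `h` is at least half-dense on `P ∩ Q`.  Census (memo §3, exp5): 251/400 random genuine cells.
HONEST FRAMING: a face; `C_3`, `T₁`, `T₁(|C| = 1)` remain OPEN. [this work]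
-/

noncomputable section

open scoped Classical

namespace Summit.CriticalPhenomena.PercolationContinuityZ3.Theorems

namespace SahiSharedTwoPointCube

open Finset Function
open Literature.Combinatorics.Sahi2008
open Literature.Probability.Percolation.DecisionTree (ind ind_of_mem ind_of_not_mem ind_nonneg)

variable {κ : Type} [Fintype κ]

/-! ### The `c`-decoupling face: one more shared coordinate, paid by gen 25's level-splitting defect -/

/-- **THE `c`-DECOUPLING FACE.**  Increasing events `X, Y, Z ⊆ 2^κ`, a coordinate `c` such that `X` and `Y` share at most one essential coordinate
other than `c` (`Z` unrestricted), and a product measure `μ_p` at which the level-splitting defect of `X` at `c` (gen 25,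
`SahiLevelSplit.sahiE_three_eq_levelSplit`) is nonnegative.  Then `E_3(μ_p; 1_X, 1_Y, 1_Z) ≥ 0`: the two triples frozen at the `c`-sections of `X`
share at most one essential coordinate between their first two members (`esupp (X^{c←b}) ⊆ esupp X ∖ {c}`), hence are nonnegative by
`sahiE_three_nonneg_of_esupp_inter_subsingleton`, and `SahiLevelSplit.sahiE_three_nonneg_of_levelDefect_nonneg` concludes. [this work] -/
theorem sahiE_three_nonneg_of_levelDefect_nonneg_of_shared_le_one {X Y Z : Set (Set κ)}
    (hX : IsUpperSet X) (hY : IsUpperSet Y) (hZ : IsUpperSet Z) (p : κ → unitInterval) (c : κ)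
    (hC : ∀ x y, x ≠ c → y ≠ c → x ∈ esupp X → x ∈ esupp Y → y ∈ esupp X → y ∈ esupp Y → x = y)
    (hD : 0 ≤ ex (bernoulliWeight p) (fun ω =>
        (ind (secAt c true X) ω - ind (secAt c false X) ω) *
          (2 * (ind (secAt c true Y) ω * ind (secAt c true Z) ω - ind (secAt c false Y) ω * ind (secAt c false Z) ω)
            - ex (bernoulliWeight p) (ind Y) * (ind (secAt c true Z) ω - ind (secAt c false Z) ω)
            - ex (bernoulliWeight p) (ind Z) * (ind (secAt c true Y) ω - ind (secAt c false Y) ω)))) :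
    0 ≤ sahiE (bernoulliWeight p) 3 ![ind X, ind Y, ind Z] := by
  have frozen : ∀ b : Bool, 0 ≤ sahiE (bernoulliWeight p) 3 ![ind (secAt c b X), ind Y, ind Z] := by
    intro b
    refine sahiE_three_nonneg_of_esupp_inter_subsingleton (isUpperSet_secAt c b hX) hY hZ (fun x y hx hxY hy hyY => ?_) p
    have hx' := Finset.mem_erase.1 (esupp_secAt_subset hX c b hx)
    have hy' := Finset.mem_erase.1 (esupp_secAt_subset hX c b hy)
    exact hC x y hx'.1 hy'.1 hx'.2 hxY hy'.2 hyY
  exact SahiLevelSplit.sahiE_three_nonneg_of_levelDefect_nonneg p c X Y Z hD (frozen false) (frozen true)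

end SahiSharedTwoPointCube

end Summit.CriticalPhenomena.PercolationContinuityZ3.Theorems
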